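import Summits.PneNP.PneNP.Theorems.ChebyshevTracialDesignGammaDirectionSecondMomentRelativeAtoms
import Summits.PneNP.PneNP.Theorems.ChebyshevTracialDesignGammaDirectionSecondMomentRelativeOrders
import HarnessLib

/-!
# Cell pnp-psdrank, route `ChebyshevTracialDesign`: the centred second moment's level-smoothness sum in RELATIVE form —
# hypothesis (hA) of brick 130 with an explicit `ε_A` (crux `TracialDecayExp20`, stmt-PneNP-19878)

Brick 139 (prover g28; MEMO-30 rev 3 §3b/§4, MEMO-31). Brick 130's centred-basis criterion for the γ-direction asks, at every window point `x`,
for (hA) `Σ_{k=1}^D c_k|Δ^k_j A^m_{2j+1}(x)(0)| ≤ ε_A·A^m_1(x)`, `A^m_c(x) = E_c[1_{X=x}(n_A − m)²]`, `c_k = C(2k,k)/4^k`, with the centring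
`m = E_1[n_A | X = x]` (`B^m_1(x) = 0`). Brick 138 gave the LEFT side as `½·FIRST + Σ_{k∈[2,D]} SECOND_k` from per-order budgets `R₀, R₁, R₂`
of the three law families of the Leibniz split. This file closes the passage:

* **`sum_abs_fwdDiff_centredSecond_le_rel`**: for a perfect matching `M` on `Fin n` (`n = 2N₀`), a block `H` of type `(a,b,d)`, cut `2r+7`,
  orders `D`, a window point `x ≥ 1`, the hypotheses of brick 138's `k = 1` leg (margins, §7-numerics, the level-`1` constants `E`, `Far`),
  the centring `B^m_1(x) = 0`, budgets of Lq SHAPE for the three families — `c_k|Δ^kG_r(0)| ≤ Γ·q^k·G_r(0) + κ_r·(4/3)^k·τ` for `1 ≤ k ≤ D`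
  with ONE `(Γ, q, τ)` (`1 ≤ Γ`, `0 ≤ q ≤ 1`, `0 ≤ τ`; `κ = (1, a, a²)`; the tree's `abs_fwdDiff_iter_shellLaw_le_of_hyps` and brick 136's
  `levelBudget_pin1/_pin2` deliver this shape with family-dependent `Γ_r ≤ Γ`, `q_r ≤ q`, `τ_r ≤ τ`) — the variance floor (V)
  `V·law_1(x) ≤ A^m_1(x)` (lit: `centredSq_section_ge_of_brackets` / `var_lineW_ge_of_window`) and the window floor `LB ≤ law_1(x)`:
  `Σ_{k∈[1,D]} c_k|Δ^k A^m(0)| ≤ ε_A·A^m_1(x)`, `ε_A = α + λ/V + (μ·τ + φ·Far)/(LB·V)` with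
  `α = E·R/4 + 1/(r+1)` (`R = n(n−2)/((2r+6)(n−2r−8))`), `λ = λ₁ + λ₂`, `μ = μ₁ + μ₂`, `φ` the explicit coefficients of
  `…SecondMomentRelativeFirst.first_half_le` and `…SecondMomentRelativeOrders.second_le_of_shapes` (printed in full in the statement).
READING (MEMO-30 §3b (c)): every piece of `ε_A` is `O(E) + O(a²/(r·V)) + O(ΓqN/V) + O(D³Γa²/(T²V)) + tails/(LB·V)`; with `V ≍ c(β)N`,
`r ≍ N`, `q ≍ D/(β⁹N)`, `D⁴ ≤ n` it tends to `0` — ASYMPTOTIC ONLY, the numerics (`ε_A + ε_B ≤ 1` from an `n₀` on) are the next brick, as are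
the discharge of (V) from lit's line-section floor, of the budgets from Lq/brick 136 (+`lqMargins_mono`), and the plug into bricks 130/134.
WHAT THIS FILE DOES NOT DO: those four things, anything on `TracialDecayExp20` itself, psd rank of P_PM(K_n), or P vs NP.
[cite: Rothvoss2017, §2 (PDF p. 6)] [cite: RollinRoss2010, §3 (Lemma 3.3), §4.1 Thm 4.2] [cite: Boole2009, Ch. II Art. 10 Ex. 3 eq. (8)]
Stature: support/instrument (kernel lane, no defs, axioms standard; constants asymptotic only). Supports stmt-PneNP-19878.
-/

set_option linter.dupNamespace false -- `Summit.PneNP.PneNP.…`: summit = sub-problem (D-0017)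

noncomputable section

namespace Summit.PneNP.PneNP.Theorems.ChebyshevTracialDesignGammaDirectionSecondMomentRelative

open Finset Polynomial Literature.Barriers.PneNP Literature.Combinatorics.Optimization
open Literature.Combinatorics.Optimization.ShellStep
open Summit.PneNP.PneNP.Theorems.ChebyshevTracialDesignShellOperatorForm (shell_partner_nonempty)
open Summit.PneNP.PneNP.Theorems.ChebyshevTracialDesignGammaDirectionSecondMomentBudget (sum_abs_fwdDiff_centredSecond_le_of_budgets)
open Summit.PneNP.PneNP.Theorems.ChebyshevTracialDesignGammaDirectionSecondMomentRelativeOrders (sum_Ico_two_budget_le second_le_of_shapes)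
open Summit.PneNP.PneNP.Theorems.ChebyshevTracialDesignGammaDirectionSecondMomentRelativeFirst (first_half_le rel_of_floor)
open Summit.PneNP.PneNP.Theorems.ChebyshevTracialDesignGammaDirectionSecondMomentRelativeAtoms

variable {n : ℕ}

/-! ### §0 Nonnegativity of the collected coefficients (clean-context helpers) -/

/-- `0 ≤ λ₁ + λ₂`. [cite: Rothvoss2017, §2 (PDF p. 6)] -/
theorem lam_nonneg (r a D : ℕ) {E Rr Γ q : ℝ} (hE : 0 ≤ E) (hRr : 0 ≤ Rr) (hΓ : 0 ≤ Γ) (hq : 0 ≤ q) :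
    0 ≤ (E * Rr / 4 * (2 * (a : ℝ) ^ 2 / ((r : ℝ) + 1) + (2 * (a : ℝ) + 1) * a / ((r : ℝ) + 2)) +
            (2 * (a : ℝ) + 1) * ((r : ℝ) + 3) / (2 * ((r : ℝ) + 2) * ((r : ℝ) + 1)) *
              ((a : ℝ) * (4 * Γ * q + (2 + 4 * Γ * q) / (2 * (r : ℝ) + 6))) +
            (a : ℝ) * (2 * (a : ℝ) + r + 3) / (2 * ((r : ℝ) + 2) * ((r : ℝ) + 1)) * (1 + 2 * Γ * q)) +
      (D : ℝ) * (2 * Γ * q ^ 2 * (a : ℝ) ^ 2 + 8 * (D : ℝ) * Γ * q * (a : ℝ) ^ 2 / (2 * (r : ℝ) + 6) +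
            32 * (D : ℝ) ^ 2 * Γ * (a : ℝ) ^ 2 / ((2 * (r : ℝ) + 6) * (2 * (r : ℝ) + 4)) +
            (2 * (a : ℝ) + 1) * a * (Γ * q ^ 2 + 4 * (D : ℝ) * Γ * q / (2 * (r : ℝ) + 6))) := by positivity

/-- `0 ≤ (μ₁ + μ₂)·τ + φ·Far`. [cite: Rothvoss2017, §2 (PDF p. 6)] -/
theorem mu_nonneg (r a D : ℕ) {K ν τ Far : ℝ} (hK : 0 < K) (hν : 0 < ν) (hτ : 0 ≤ τ) (hFar : 0 ≤ Far) :
    0 ≤ (((2 * (a : ℝ) + 1) * ((r : ℝ) + 3) / (2 * ((r : ℝ) + 2) * ((r : ℝ) + 1)) * (16 * (a : ℝ) / 3) +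
            (a : ℝ) * (2 * (a : ℝ) + r + 3) / (2 * ((r : ℝ) + 2) * ((r : ℝ) + 1)) * (8 / 3)) +
        (D : ℝ) * (4 / 3 : ℝ) ^ D *
            ((a : ℝ) ^ 2 * ((2 * (r : ℝ) + 6) * (2 * (r : ℝ) + 4) / K + 8 * (D : ℝ) * (2 * (r : ℝ) + 4) / K +
                32 * (D : ℝ) ^ 2 / K + 1) +
              (2 * (a : ℝ) + 1) * a * ((2 * (r : ℝ) + 6 + 4 * D) / ν))) * τ +
      ((((r : ℝ) + 2 + a) ^ 2 + 2 * ((r : ℝ) + 2) ^ 2 / ((r : ℝ) + 1) + (2 * (a : ℝ) + 1)) / 4) * Far := by positivity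

/-- **THE CENTRED SECOND MOMENT'S LEVEL-SMOOTHNESS SUM, RELATIVE FORM (brick 139)** — hypothesis (hA) of brick 130 at one window point with
an explicit `ε_A` (see the module docstring for the reading and for what is NOT here). [cite: Rothvoss2017, §2 (PDF p. 6)]
[cite: RollinRoss2010, §3 (Lemma 3.3), §4.1 Thm 4.2] [cite: Boole2009, Ch. II Art. 10 Ex. 3 eq. (8)] -/
theorem sum_abs_fwdDiff_centredSecond_le_rel (M : PMatch n) (H : Finset (Fin n)) {a b d N₀ : ℕ}
    (ha : (reps M.2.partner (vAA M.2.partner univ H)).card = a)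
    (hb : (reps M.2.partner (vBH M.2.partner univ H ∪ vBN M.2.partner univ H)).card = b)
    (hd : (reps M.2.partner (vDD M.2.partner univ H)).card = d) (hN : a + b + d = N₀) (hn : n = 2 * N₀)
    {β : ℝ} (hβ : 0 < β) (hβ1 : β ≤ 1) (hbβ : β * N₀ + 3 ≤ b) (hdβ : β * N₀ + 3 ≤ d)
    {r : ℕ} (hs : β * N₀ ≤ (r : ℝ) + 2) (hs' : 8 * ((r : ℝ) + 2) ≤ (4 + β) * ((N₀ : ℝ) - 2)) (hrN : r + 4 ≤ N₀)
    (hN16 : 16 ≤ N₀) {D : ℕ} (hD1 : 1 ≤ D) (hDr : 2 * D ≤ 2 * r + 6) (hDn : 2 * r + 1 + 6 + (2 * D + 1) ≤ n)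
    {x : ℕ} (hx1 : 1 ≤ x) {ε : ℝ}
    (hxε : |(x : ℝ) - (2 * ((r : ℝ) + 3) + 1) * (2 * a + b) / (2 * N₀)| ≤ ε)
    {L : ℝ} (h2L : 2 ≤ L) (hLN : L - 2 ≤ 2 * ((N₀ : ℝ) - 2))
    (hL1 : L + 1 + (ε + 15) ≤ β * ((r : ℝ) + 2)) (hL2 : L + 1 + (ε + 15) + 3 ≤ β * ((N₀ : ℝ) - 2) / 8)
    (hwin : 2 * (L + 1 + 1) ≤ (β ^ 2 / 8) ^ 2 * (β * ((N₀ : ℝ) - 2))) (hN4 : 4 ≤ β * ((N₀ : ℝ) - 2))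
    (hkV : (1 : ℝ) * (1 + 8 * (L + 1 + 1) / ((β ^ 2 / 8) ^ 4 * (β * ((N₀ : ℝ) - 2)))) ≤
      (β ^ 2 / 8) ^ 4 * (β * ((N₀ : ℝ) - 2)))
    (m : ℝ)
    (hcentre : ((∑ U ∈ ((shell M.2.partner (2 * r + 1 + 6) 1).filter fun U => ((U ∩ H).card : ℤ) = x),
          (((((reps M.2.partner (vAA M.2.partner univ H)).filter fun v => v ∈ U ∧ M.2.partner v ∈ U).card : ℕ) : ℝ) - m)) /
          ((shell M.2.partner (2 * r + 1 + 6) 1).card : ℝ)) = 0)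
    (P₁ P₂ P₃ : Finset (Fin n) → ℕ → ℤ → ℝ)
    (hP₁ : ∀ T t' y, P₁ T t' y = (∑ U ∈ ((shellIn M.2.partner T t' 1).filter fun U => ((U ∩ H).card : ℤ) = y),
        (((((reps M.2.partner (vAA M.2.partner T H)).filter fun v => v ∈ U ∧ M.2.partner v ∈ U).card : ℕ) : ℝ) - m) ^ 2) /
        ((shellIn M.2.partner T t' 1).card : ℝ))
    (hP₂ : ∀ T t' y, P₂ T t' y = (∑ U ∈ ((shellIn M.2.partner T t' 1).filter fun U => ((U ∩ H).card : ℤ) = y),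
        (((((reps M.2.partner (vAA M.2.partner T H)).filter fun v => v ∈ U ∧ M.2.partner v ∈ U).card : ℕ) : ℝ) *
          (((((reps M.2.partner (vAA M.2.partner T H)).filter fun v => v ∈ U ∧ M.2.partner v ∈ U).card : ℕ) : ℝ) - 1))) /
        ((shellIn M.2.partner T t' 1).card : ℝ))
    (hP₃ : ∀ T t' y, P₃ T t' y = (∑ U ∈ ((shellIn M.2.partner T t' 1).filter fun U => ((U ∩ H).card : ℤ) = y),
        ((((reps M.2.partner (vAA M.2.partner T H)).filter fun v => v ∈ U ∧ M.2.partner v ∈ U).card : ℕ) : ℝ)) /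
        ((shellIn M.2.partner T t' 1).card : ℝ))
    {E Far : ℝ} (hE0 : 0 ≤ E) (hFar0 : 0 ≤ Far)
    (hE : (((1 + 8 * (L + 1 + 1) / ((β ^ 2 / 8) ^ 4 * (β * ((N₀ : ℝ) - 2)))) *
            (8 * (L + 1 + 1) / ((β ^ 2 / 8) ^ 4 * (β * ((N₀ : ℝ) - 2))) +
              2 * Real.sqrt 192 * Real.sqrt (2 * (2 * (1 : ℝ) + 1) *
                (1 + 8 * (L + 1 + 1) / ((β ^ 2 / 8) ^ 4 * (β * ((N₀ : ℝ) - 2)))) /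
                  ((β ^ 2 / 8) ^ 4 * (β * ((N₀ : ℝ) - 2)))))) ^ (2 * 1) *
          (1 + 4 * (Real.sqrt ((N₀ : ℝ) - 2) + 1) / 3 *
            (2 * Real.sqrt 192 * Real.sqrt (2 * (2 * (1 : ℝ) + 1) *
              (1 + 8 * (L + 1 + 1) / ((β ^ 2 / 8) ^ 4 * (β * ((N₀ : ℝ) - 2)))) /
                ((β ^ 2 / 8) ^ 4 * (β * ((N₀ : ℝ) - 2))))))) ≤ E)
    (hFar : (4 : ℝ) ^ 1 * Real.exp (-((L - 2 * 1) ^ 2 / (4 * ((N₀ : ℝ) - 2)))) ≤ Far)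
    {Γ q τ : ℝ} (hΓ : 1 ≤ Γ) (hq0 : 0 ≤ q) (hq1 : q ≤ 1) (hτ : 0 ≤ τ)
    (hq₀ : ∀ k ∈ Ico 1 (D + 1), (((2 * k).choose k : ℕ) : ℝ) / (4 : ℝ) ^ k *
        |(fwdDiff (1 : ℕ))^[k] (fun j : ℕ => shellLaw M.2.partner univ H (2 * r + 1 + 6) (2 * j + 1) x) 0| ≤
      Γ * q ^ k * shellLaw M.2.partner univ H (2 * r + 1 + 6) 1 x + (4 / 3 : ℝ) ^ k * τ)
    (hq₁ : ∀ k ∈ Ico 1 (D + 1), (((2 * k).choose k : ℕ) : ℝ) / (4 : ℝ) ^ k *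
        |(fwdDiff (1 : ℕ))^[k] (fun j : ℕ => ∑ v ∈ reps M.2.partner (vAA M.2.partner univ H),
          shellLaw M.2.partner (univ \ {v, M.2.partner v}) H (2 * r + 3 + 2) (2 * j + 1) (x - 2)) 0| ≤
      Γ * q ^ k * (∑ v ∈ reps M.2.partner (vAA M.2.partner univ H),
        shellLaw M.2.partner (univ \ {v, M.2.partner v}) H (2 * r + 3 + 2) 1 (x - 2)) + (a : ℝ) * ((4 / 3 : ℝ) ^ k * τ))
    (hq₂ : ∀ k ∈ Ico 1 (D + 1), (((2 * k).choose k : ℕ) : ℝ) / (4 : ℝ) ^ k *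
        |(fwdDiff (1 : ℕ))^[k] (fun j : ℕ => ∑ v ∈ reps M.2.partner (vAA M.2.partner univ H),
          ∑ w ∈ (reps M.2.partner (vAA M.2.partner univ H)).erase v,
            shellLaw M.2.partner (del2 M.2.partner univ v w) H (2 * r + 3) (2 * j + 1) (x - 4)) 0| ≤
      Γ * q ^ k * (∑ v ∈ reps M.2.partner (vAA M.2.partner univ H), ∑ w ∈ (reps M.2.partner (vAA M.2.partner univ H)).erase v,
          shellLaw M.2.partner (del2 M.2.partner univ v w) H (2 * r + 3) 1 (x - 4)) + (a : ℝ) ^ 2 * ((4 / 3 : ℝ) ^ k * τ))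
    {V LB : ℝ} (hV : 0 < V) (hLB : 0 < LB) (hVA : V * shellLaw M.2.partner univ H (2 * r + 1 + 6) 1 x ≤ P₁ univ (2 * r + 1 + 6) x)
    (hLBl : LB ≤ shellLaw M.2.partner univ H (2 * r + 1 + 6) 1 x) :
    ∑ k ∈ Ico 1 (D + 1), (((2 * k).choose k : ℕ) : ℝ) / (4 : ℝ) ^ k *
        |(fwdDiff (1 : ℕ))^[k] (fun j : ℕ =>
          (∑ U ∈ ((shellIn M.2.partner univ (2 * r + 1 + 6) (2 * j + 1)).filter fun U => ((U ∩ H).card : ℤ) = x),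
            (((((reps M.2.partner (vAA M.2.partner univ H)).filter fun v => v ∈ U ∧ M.2.partner v ∈ U).card : ℕ) : ℝ) - m) ^ 2) /
            ((shellIn M.2.partner univ (2 * r + 1 + 6) (2 * j + 1)).card : ℝ)) 0| ≤
      ((E * ((n : ℝ) * ((n : ℝ) - 2) / ((2 * (r : ℝ) + 6) * ((n : ℝ) - 2 * r - 8))) / 4 + 1 / ((r : ℝ) + 1)) +
          ((E * ((n : ℝ) * ((n : ℝ) - 2) / ((2 * (r : ℝ) + 6) * ((n : ℝ) - 2 * r - 8))) / 4 * (2 * (a : ℝ) ^ 2 / ((r : ℝ) + 1) + (2 * (a : ℝ) + 1) * a / ((r : ℝ) + 2)) +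
            (2 * (a : ℝ) + 1) * ((r : ℝ) + 3) / (2 * ((r : ℝ) + 2) * ((r : ℝ) + 1)) *
              ((a : ℝ) * (4 * Γ * q + (2 + 4 * Γ * q) / (2 * (r : ℝ) + 6))) +
            (a : ℝ) * (2 * (a : ℝ) + r + 3) / (2 * ((r : ℝ) + 2) * ((r : ℝ) + 1)) * (1 + 2 * Γ * q)) +
            (D : ℝ) * (2 * Γ * q ^ 2 * (a : ℝ) ^ 2 + 8 * (D : ℝ) * Γ * q * (a : ℝ) ^ 2 / (2 * (r : ℝ) + 6) +
            32 * (D : ℝ) ^ 2 * Γ * (a : ℝ) ^ 2 / ((2 * (r : ℝ) + 6) * (2 * (r : ℝ) + 4)) +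
            (2 * (a : ℝ) + 1) * a * (Γ * q ^ 2 + 4 * (D : ℝ) * Γ * q / (2 * (r : ℝ) + 6)))) / V +
          ((((2 * (a : ℝ) + 1) * ((r : ℝ) + 3) / (2 * ((r : ℝ) + 2) * ((r : ℝ) + 1)) * (16 * (a : ℝ) / 3) +
            (a : ℝ) * (2 * (a : ℝ) + r + 3) / (2 * ((r : ℝ) + 2) * ((r : ℝ) + 1)) * (8 / 3)) +
              (D : ℝ) * (4 / 3 : ℝ) ^ D *
            ((a : ℝ) ^ 2 * ((2 * (r : ℝ) + 6) * (2 * (r : ℝ) + 4) / ((n : ℝ) * ((n : ℝ) - 2)) + 8 * (D : ℝ) * (2 * (r : ℝ) + 4) / ((n : ℝ) * ((n : ℝ) - 2)) +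
                32 * (D : ℝ) ^ 2 / ((n : ℝ) * ((n : ℝ) - 2)) + 1) +
              (2 * (a : ℝ) + 1) * a * ((2 * (r : ℝ) + 6 + 4 * D) / (n : ℝ)))) * τ +
            ((((r : ℝ) + 2 + a) ^ 2 + 2 * ((r : ℝ) + 2) ^ 2 / ((r : ℝ) + 1) + (2 * (a : ℝ) + 1)) / 4) * Far) / (LB * V)) *
        P₁ univ (2 * r + 1 + 6) x := by
  classical
  -- the matching and its ground set
  have hπ : ∀ v, M.2.partner (M.2.partner v) = v := partner_partner M
  have hπ' : ∀ v, M.2.partner v ≠ v := partner_ne M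
  have hst : ∀ v ∈ (univ : Finset (Fin n)), M.2.partner v ∈ univ := fun v _ => mem_univ _
  have hncard : ((univ : Finset (Fin n)).card : ℝ) = n := by rw [card_univ, Fintype.card_fin]
  have hn4 : 4 ≤ n := by omega
  have hrn10 : 2 * r + 10 ≤ n := by omega
  have hn10 : 2 * (r : ℝ) + 10 ≤ n := by exact_mod_cast hrn10
  have hr0 : (0 : ℝ) ≤ r := Nat.cast_nonneg r
  have ha0 : (0 : ℝ) ≤ a := Nat.cast_nonneg a
  have hD0 : (0 : ℝ) ≤ D := Nat.cast_nonneg D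
  have hn0 : (0 : ℝ) < n := by linarith only [hn10, hr0]
  have hΓ0 : 0 ≤ Γ := zero_le_one.trans hΓ
  have hT2 : (2 : ℝ) ≤ 2 * (r : ℝ) + 6 := by linarith only [hr0]
  have hT0 : (0 : ℝ) < 2 * (r : ℝ) + 6 := by linarith only [hr0]
  have hn2pos : (0 : ℝ) < (n : ℝ) - 2 := by linarith only [hn10, hr0]
  have hn2 : (n : ℝ) - 2 ≠ 0 := hn2pos.ne'
  have hK0 : 0 < (n : ℝ) * ((n : ℝ) - 2) := mul_pos hn0 hn2pos
  -- the level-`1` law and the floors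
  have hlaw0 : 0 ≤ shellLaw M.2.partner univ H (2 * r + 1 + 6) 1 x := shellLaw_nonneg (π := M.2.partner) _ _ _ _ _
  have hlawpos : 0 < shellLaw M.2.partner univ H (2 * r + 1 + 6) 1 x := lt_of_lt_of_le hLB hLBl
  have hne1 : (shell M.2.partner (2 * r + 1 + 6) 1).Nonempty :=
    shell_partner_nonempty M ⟨r + 3, by ring⟩ ⟨0, by ring⟩ (by omega) (by omega)
  have hm0 : 0 ≤ m := centre_nonneg M H (2 * r + 1 + 6) x m hne1 hcentre hlawpos
  have hma : m ≤ a := centre_le M H ha (2 * r + 1 + 6) x m hne1 hcentre hlawpos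
  have h1mem : 1 ∈ Ico 1 (D + 1) := by rw [mem_Ico]; omega
  -- the sections `A`, `F²`, `F¹` at level `1`
  have hA0 : 0 ≤ P₁ univ (2 * r + 1 + 6) x := by
    rw [hP₁]; exact div_nonneg (sum_nonneg fun _ _ => sq_nonneg _) (Nat.cast_nonneg _)
  have hF2_0 : 0 ≤ P₂ univ (2 * r + 1 + 6) x := by rw [hP₂]; exact secondFactorial_nonneg M H _ 1 _
  have hF2a : P₂ univ (2 * r + 1 + 6) x ≤ (a : ℝ) ^ 2 * shellLaw M.2.partner univ H (2 * r + 1 + 6) 1 x := by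
    rw [hP₂]; exact secondFactorial_le M H ha _ 1 _
  have hF1_0 : 0 ≤ P₃ univ (2 * r + 1 + 6) x := by rw [hP₃]; exact firstFactorial_nonneg M H _ 1 _
  have hF1a : P₃ univ (2 * r + 1 + 6) x ≤ (a : ℝ) * shellLaw M.2.partner univ H (2 * r + 1 + 6) 1 x := by
    rw [hP₃]; exact firstFactorial_le M H ha _ 1 _
  -- the level-`1` values of the pinned families
  have hG1_0 : 0 ≤ (∑ v ∈ reps M.2.partner (vAA M.2.partner univ H),
        shellLaw M.2.partner (univ \ {v, M.2.partner v}) H (2 * r + 3 + 2) 1 (x - 2)) :=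
    sum_nonneg fun _ _ => shellLaw_nonneg (π := M.2.partner) _ _ _ _ _
  have hG2_0 : 0 ≤ (∑ v ∈ reps M.2.partner (vAA M.2.partner univ H), ∑ w ∈ (reps M.2.partner (vAA M.2.partner univ H)).erase v,
          shellLaw M.2.partner (del2 M.2.partner univ v w) H (2 * r + 3) 1 (x - 4)) :=
    sum_nonneg fun _ _ => sum_nonneg fun _ _ => shellLaw_nonneg (π := M.2.partner) _ _ _ _ _
  have hg₁ : (∑ v ∈ reps M.2.partner (vAA M.2.partner univ H),
        shellLaw M.2.partner (univ \ {v, M.2.partner v}) H (2 * r + 3 + 2) 1 (x - 2)) ≤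
      (n : ℝ) / (2 * (r : ℝ) + 6) * ((a : ℝ) * shellLaw M.2.partner univ H (2 * r + 1 + 6) 1 x) := by
    have h1 := firstFactorial_le M H ha (2 * r + 1 + 6) 1 (x : ℤ)
    rw [firstFactorial_eq M H (r := r) (by omega) (x : ℤ)] at h1
    rw [div_mul_eq_mul_div, le_div_iff₀ hT0]
    calc (∑ v ∈ reps M.2.partner (vAA M.2.partner univ H),
        shellLaw M.2.partner (univ \ {v, M.2.partner v}) H (2 * r + 3 + 2) 1 (x - 2)) * (2 * (r : ℝ) + 6)
        = (n : ℝ) * ((2 * (r : ℝ) + 6) / (n : ℝ) * (∑ v ∈ reps M.2.partner (vAA M.2.partner univ H),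
        shellLaw M.2.partner (univ \ {v, M.2.partner v}) H (2 * r + 3 + 2) 1 (x - 2))) := by
          field_simp
      _ ≤ (n : ℝ) * ((a : ℝ) * shellLaw M.2.partner univ H (2 * r + 1 + 6) 1 x) := mul_le_mul_of_nonneg_left h1 hn0.le
  have hg₂ : (∑ v ∈ reps M.2.partner (vAA M.2.partner univ H), ∑ w ∈ (reps M.2.partner (vAA M.2.partner univ H)).erase v,
          shellLaw M.2.partner (del2 M.2.partner univ v w) H (2 * r + 3) 1 (x - 4)) ≤
      ((n : ℝ) * ((n : ℝ) - 2)) / ((2 * (r : ℝ) + 6) * (2 * (r : ℝ) + 4)) * ((a : ℝ) ^ 2 * shellLaw M.2.partner univ H (2 * r + 1 + 6) 1 x) := by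
    have h1 := secondFactorial_le M H ha (2 * r + 1 + 6) 1 (x : ℤ)
    rw [secondFactorial_eq M H (r := r) (by omega) (x : ℤ)] at h1
    have hTT : (0 : ℝ) < (2 * (r : ℝ) + 6) * (2 * (r : ℝ) + 4) := by positivity
    rw [div_mul_eq_mul_div, le_div_iff₀ hTT]
    calc (∑ v ∈ reps M.2.partner (vAA M.2.partner univ H), ∑ w ∈ (reps M.2.partner (vAA M.2.partner univ H)).erase v,
          shellLaw M.2.partner (del2 M.2.partner univ v w) H (2 * r + 3) 1 (x - 4)) * ((2 * (r : ℝ) + 6) * (2 * (r : ℝ) + 4))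
        = ((n : ℝ) * ((n : ℝ) - 2)) * ((2 * (r : ℝ) + 6) * (2 * (r : ℝ) + 4) / ((n : ℝ) * ((n : ℝ) - 2)) * (∑ v ∈ reps M.2.partner (vAA M.2.partner univ H), ∑ w ∈ (reps M.2.partner (vAA M.2.partner univ H)).erase v,
          shellLaw M.2.partner (del2 M.2.partner univ v w) H (2 * r + 3) 1 (x - 4))) := by
          field_simp
      _ ≤ ((n : ℝ) * ((n : ℝ) - 2)) * ((a : ℝ) ^ 2 * shellLaw M.2.partner univ H (2 * r + 1 + 6) 1 x) := mul_le_mul_of_nonneg_left h1 hK0.le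
  -- the budgets in brick 138's currency (`i = 0` added)
  obtain ⟨R₀, hR₀d⟩ : ∃ f : ℕ → ℝ, ∀ i, f i = Γ * q ^ i * shellLaw M.2.partner univ H (2 * r + 1 + 6) 1 x + 1 * ((4 / 3 : ℝ) ^ i * τ) :=
    ⟨fun i => Γ * q ^ i * shellLaw M.2.partner univ H (2 * r + 1 + 6) 1 x + 1 * ((4 / 3 : ℝ) ^ i * τ), fun _ => rfl⟩
  obtain ⟨R₁, hR₁d⟩ : ∃ f : ℕ → ℝ, ∀ i, f i = Γ * q ^ i * (∑ v ∈ reps M.2.partner (vAA M.2.partner univ H),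
        shellLaw M.2.partner (univ \ {v, M.2.partner v}) H (2 * r + 3 + 2) 1 (x - 2)) + (a : ℝ) * ((4 / 3 : ℝ) ^ i * τ) :=
    ⟨fun i => Γ * q ^ i * (∑ v ∈ reps M.2.partner (vAA M.2.partner univ H),
        shellLaw M.2.partner (univ \ {v, M.2.partner v}) H (2 * r + 3 + 2) 1 (x - 2)) + (a : ℝ) * ((4 / 3 : ℝ) ^ i * τ), fun _ => rfl⟩
  obtain ⟨R₂, hR₂d⟩ : ∃ f : ℕ → ℝ, ∀ i, f i = Γ * q ^ i * (∑ v ∈ reps M.2.partner (vAA M.2.partner univ H), ∑ w ∈ (reps M.2.partner (vAA M.2.partner univ H)).erase v,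
          shellLaw M.2.partner (del2 M.2.partner univ v w) H (2 * r + 3) 1 (x - 4)) + (a : ℝ) ^ 2 * ((4 / 3 : ℝ) ^ i * τ) :=
    ⟨fun i => Γ * q ^ i * (∑ v ∈ reps M.2.partner (vAA M.2.partner univ H), ∑ w ∈ (reps M.2.partner (vAA M.2.partner univ H)).erase v,
          shellLaw M.2.partner (del2 M.2.partner univ v w) H (2 * r + 3) 1 (x - 4)) + (a : ℝ) ^ 2 * ((4 / 3 : ℝ) ^ i * τ), fun _ => rfl⟩
  have hR₀ : ∀ i, i ≤ D → (((2 * i).choose i : ℕ) : ℝ) / (4 : ℝ) ^ i *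
      |(fwdDiff (1 : ℕ))^[i] (fun j : ℕ => shellLaw M.2.partner univ H (2 * r + 1 + 6) (2 * j + 1) x) 0| ≤ R₀ i := by
    intro i hi
    rw [hR₀d]
    rcases Nat.eq_zero_or_pos i with rfl | hi1
    · simp only [Nat.choose_zero_right, Nat.cast_one, pow_zero, div_one, one_mul, Function.iterate_zero, id_eq,
        mul_one, mul_zero, zero_add]
      rw [abs_of_nonneg hlaw0]
      have h1 := mul_nonneg (sub_nonneg.2 hΓ) hlaw0
      linarith only [h1, hτ]
    · rw [one_mul]; exact hq₀ i (mem_Ico.2 ⟨hi1, Nat.lt_succ_of_le hi⟩)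
  have hR₁ : ∀ i, i ≤ D → (((2 * i).choose i : ℕ) : ℝ) / (4 : ℝ) ^ i *
      |(fwdDiff (1 : ℕ))^[i] (fun j : ℕ => ∑ v ∈ reps M.2.partner (vAA M.2.partner univ H),
        shellLaw M.2.partner (univ \ {v, M.2.partner v}) H (2 * r + 3 + 2) (2 * j + 1) (x - 2)) 0| ≤ R₁ i := by
    intro i hi
    rw [hR₁d]
    rcases Nat.eq_zero_or_pos i with rfl | hi1
    · simp only [Nat.choose_zero_right, Nat.cast_one, pow_zero, div_one, one_mul, Function.iterate_zero, id_eq,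
        mul_one, mul_zero, zero_add]
      rw [abs_of_nonneg hG1_0]
      have h1 := mul_nonneg (sub_nonneg.2 hΓ) hG1_0
      have h2 := mul_nonneg ha0 hτ
      linarith only [h1, h2]
    · exact hq₁ i (mem_Ico.2 ⟨hi1, Nat.lt_succ_of_le hi⟩)
  have hR₂ : ∀ i, i ≤ D → (((2 * i).choose i : ℕ) : ℝ) / (4 : ℝ) ^ i *
      |(fwdDiff (1 : ℕ))^[i] (fun j : ℕ => ∑ v ∈ reps M.2.partner (vAA M.2.partner univ H),
        ∑ w ∈ (reps M.2.partner (vAA M.2.partner univ H)).erase v,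
          shellLaw M.2.partner (del2 M.2.partner univ v w) H (2 * r + 3) (2 * j + 1) (x - 4)) 0| ≤ R₂ i := by
    intro i hi
    rw [hR₂d]
    rcases Nat.eq_zero_or_pos i with rfl | hi1
    · simp only [Nat.choose_zero_right, Nat.cast_one, pow_zero, div_one, one_mul, Function.iterate_zero, id_eq,
        mul_one, mul_zero, zero_add]
      rw [abs_of_nonneg hG2_0]
      have h1 := mul_nonneg (sub_nonneg.2 hΓ) hG2_0
      have h2 := mul_nonneg (sq_nonneg (a : ℝ)) hτ
      linarith only [h1, h2]
    · exact hq₂ i (mem_Ico.2 ⟨hi1, Nat.lt_succ_of_le hi⟩)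
  -- brick 138
  have h138 := sum_abs_fwdDiff_centredSecond_le_of_budgets M H ha hb hd hN hβ hβ1 hbβ hdβ hs hs' hrN hN16 hn4 hD1 hDr hDn hx1
    hxε h2L hLN hL1 hL2 hwin hN4 hkV m P₁ P₂ P₃ hP₁ hP₂ hP₃ hE0 hFar0 hE hFar R₀ R₁ R₂ hR₀ hR₁ hR₂
  rw [hncard] at h138
  -- the pair density and the two atoms of the `k = 1` leg
  have hb3 : 3 ≤ b := by
    have hN0 : (0 : ℝ) < N₀ := by exact_mod_cast (lt_of_lt_of_le (by norm_num) hN16)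
    have h1 : (0 : ℝ) < β * N₀ := mul_pos hβ hN0
    have h2 : (3 : ℝ) ≤ b := by linarith only [hbβ, h1]
    exact_mod_cast h2
  have hPF := pairDensity_le_half M H ha hb hd hN hn hb3
  have hPF0 : 0 ≤ (((vAA M.2.partner univ H).card : ℝ) * (vDD M.2.partner univ H).card +
      ∑ p ∈ vBH M.2.partner univ H, (((vBN M.2.partner univ H).erase (M.2.partner p)).card : ℝ)) / ((n : ℝ) * ((n : ℝ) - 2)) :=
    div_nonneg (add_nonneg (mul_nonneg (Nat.cast_nonneg _) (Nat.cast_nonneg _)) (sum_nonneg fun _ _ => Nat.cast_nonneg _)) hK0.le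
  have hB3 := abs_centredFirst_three_le M H ha hrn10 x hm0 hma hcentre hΓ0 hq0 hτ (hq₀ 1 h1mem) (hq₁ 1 h1mem)
  have hlaw3 := law_three_le M H r x (hq₀ 1 h1mem)
  -- the two legs in four-term form
  have hfh := first_half_le r a (n : ℝ) _ E (P₁ univ (2 * r + 1 + 6) x) (P₂ univ (2 * r + 1 + 6) x) (P₃ univ (2 * r + 1 + 6) x) _
    (shellLaw M.2.partner univ H (2 * r + 1 + 6) 1 x) (shellLaw M.2.partner univ H (2 * r + 1 + 6) (1 + 2) x) Far τ Γ q m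
    hPF0 hPF hE0 hA0 hF2_0 hF1_0 hFar0 hlaw0 hτ hΓ0 hq0 hn10 hF2a hF1a hm0 hma hB3 hlaw3
  have hsec := sum_Ico_two_budget_le D (2 * (r : ℝ) + 6) ((n : ℝ) * ((n : ℝ) - 2)) (n : ℝ) m Γ q τ (shellLaw M.2.partner univ H (2 * r + 1 + 6) 1 x)
    (∑ v ∈ reps M.2.partner (vAA M.2.partner univ H),
        shellLaw M.2.partner (univ \ {v, M.2.partner v}) H (2 * r + 3 + 2) 1 (x - 2))
    (∑ v ∈ reps M.2.partner (vAA M.2.partner univ H), ∑ w ∈ (reps M.2.partner (vAA M.2.partner univ H)).erase v,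
          shellLaw M.2.partner (del2 M.2.partner univ v w) H (2 * r + 3) 1 (x - 4))
    (a : ℝ) ((a : ℝ) ^ 2) R₀ R₁ R₂ hq0 hq1 hΓ0 hτ hlaw0 hG1_0 hG2_0 ha0 (sq_nonneg _) hK0 hn0 hT2
    (fun i _ => (hR₀d i).le) (fun i _ => (hR₁d i).le) (fun i _ => (hR₂d i).le)
  have hsec2 := second_le_of_shapes D r a (n : ℝ) m Γ q τ (shellLaw M.2.partner univ H (2 * r + 1 + 6) 1 x)
    (∑ v ∈ reps M.2.partner (vAA M.2.partner univ H),
        shellLaw M.2.partner (univ \ {v, M.2.partner v}) H (2 * r + 3 + 2) 1 (x - 2))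
    (∑ v ∈ reps M.2.partner (vAA M.2.partner univ H), ∑ w ∈ (reps M.2.partner (vAA M.2.partner univ H)).erase v,
          shellLaw M.2.partner (del2 M.2.partner univ v w) H (2 * r + 3) 1 (x - 4))
    hq0 hΓ0 hτ hlaw0 hn10 hm0 hma hg₁ hg₂
  have htot := h138.trans (add_le_add hfh (hsec.trans hsec2))
  -- opaque abbreviations for the two composite denominators
  obtain ⟨Rr, hRr⟩ : ∃ e : ℝ, e = (n : ℝ) * ((n : ℝ) - 2) / ((2 * (r : ℝ) + 6) * ((n : ℝ) - 2 * r - 8)) := ⟨_, rfl⟩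
  have hRr0 : 0 ≤ Rr := by
    rw [hRr]
    exact div_nonneg (mul_nonneg hn0.le hn2pos.le) (mul_nonneg hT0.le (by linarith only [hn10]))
  obtain ⟨K, hK⟩ : ∃ e : ℝ, e = (n : ℝ) * ((n : ℝ) - 2) := ⟨_, rfl⟩
  have hK0' : 0 < K := by rw [hK]; exact hK0
  rw [← hRr, ← hK] at htot ⊢
  -- collect and divide by the floors
  have hcol : (E * Rr / 4 + 1 / ((r : ℝ) + 1)) * P₁ univ (2 * r + 1 + 6) x +
        (E * Rr / 4 * (2 * (a : ℝ) ^ 2 / ((r : ℝ) + 1) + (2 * (a : ℝ) + 1) * a / ((r : ℝ) + 2)) +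
            (2 * (a : ℝ) + 1) * ((r : ℝ) + 3) / (2 * ((r : ℝ) + 2) * ((r : ℝ) + 1)) *
              ((a : ℝ) * (4 * Γ * q + (2 + 4 * Γ * q) / (2 * (r : ℝ) + 6))) +
            (a : ℝ) * (2 * (a : ℝ) + r + 3) / (2 * ((r : ℝ) + 2) * ((r : ℝ) + 1)) * (1 + 2 * Γ * q)) * shellLaw M.2.partner univ H (2 * r + 1 + 6) 1 x +
        ((2 * (a : ℝ) + 1) * ((r : ℝ) + 3) / (2 * ((r : ℝ) + 2) * ((r : ℝ) + 1)) * (16 * (a : ℝ) / 3) +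
            (a : ℝ) * (2 * (a : ℝ) + r + 3) / (2 * ((r : ℝ) + 2) * ((r : ℝ) + 1)) * (8 / 3)) * τ +
        ((((r : ℝ) + 2 + a) ^ 2 + 2 * ((r : ℝ) + 2) ^ 2 / ((r : ℝ) + 1) + (2 * (a : ℝ) + 1)) / 4) * Far +
      ((D : ℝ) * (2 * Γ * q ^ 2 * (a : ℝ) ^ 2 + 8 * (D : ℝ) * Γ * q * (a : ℝ) ^ 2 / (2 * (r : ℝ) + 6) +
            32 * (D : ℝ) ^ 2 * Γ * (a : ℝ) ^ 2 / ((2 * (r : ℝ) + 6) * (2 * (r : ℝ) + 4)) +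
            (2 * (a : ℝ) + 1) * a * (Γ * q ^ 2 + 4 * (D : ℝ) * Γ * q / (2 * (r : ℝ) + 6))) * shellLaw M.2.partner univ H (2 * r + 1 + 6) 1 x +
        (D : ℝ) * (4 / 3 : ℝ) ^ D *
            ((a : ℝ) ^ 2 * ((2 * (r : ℝ) + 6) * (2 * (r : ℝ) + 4) / K + 8 * (D : ℝ) * (2 * (r : ℝ) + 4) / K +
                32 * (D : ℝ) ^ 2 / K + 1) +
              (2 * (a : ℝ) + 1) * a * ((2 * (r : ℝ) + 6 + 4 * D) / (n : ℝ))) * τ) =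
      (E * Rr / 4 + 1 / ((r : ℝ) + 1)) * P₁ univ (2 * r + 1 + 6) x +
        ((E * Rr / 4 * (2 * (a : ℝ) ^ 2 / ((r : ℝ) + 1) + (2 * (a : ℝ) + 1) * a / ((r : ℝ) + 2)) +
            (2 * (a : ℝ) + 1) * ((r : ℝ) + 3) / (2 * ((r : ℝ) + 2) * ((r : ℝ) + 1)) *
              ((a : ℝ) * (4 * Γ * q + (2 + 4 * Γ * q) / (2 * (r : ℝ) + 6))) +
            (a : ℝ) * (2 * (a : ℝ) + r + 3) / (2 * ((r : ℝ) + 2) * ((r : ℝ) + 1)) * (1 + 2 * Γ * q)) +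
          (D : ℝ) * (2 * Γ * q ^ 2 * (a : ℝ) ^ 2 + 8 * (D : ℝ) * Γ * q * (a : ℝ) ^ 2 / (2 * (r : ℝ) + 6) +
            32 * (D : ℝ) ^ 2 * Γ * (a : ℝ) ^ 2 / ((2 * (r : ℝ) + 6) * (2 * (r : ℝ) + 4)) +
            (2 * (a : ℝ) + 1) * a * (Γ * q ^ 2 + 4 * (D : ℝ) * Γ * q / (2 * (r : ℝ) + 6)))) * shellLaw M.2.partner univ H (2 * r + 1 + 6) 1 x +
        ((((2 * (a : ℝ) + 1) * ((r : ℝ) + 3) / (2 * ((r : ℝ) + 2) * ((r : ℝ) + 1)) * (16 * (a : ℝ) / 3) +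
            (a : ℝ) * (2 * (a : ℝ) + r + 3) / (2 * ((r : ℝ) + 2) * ((r : ℝ) + 1)) * (8 / 3)) +
            (D : ℝ) * (4 / 3 : ℝ) ^ D *
            ((a : ℝ) ^ 2 * ((2 * (r : ℝ) + 6) * (2 * (r : ℝ) + 4) / K + 8 * (D : ℝ) * (2 * (r : ℝ) + 4) / K +
                32 * (D : ℝ) ^ 2 / K + 1) +
              (2 * (a : ℝ) + 1) * a * ((2 * (r : ℝ) + 6 + 4 * D) / (n : ℝ)))) * τ +
          ((((r : ℝ) + 2 + a) ^ 2 + 2 * ((r : ℝ) + 2) ^ 2 / ((r : ℝ) + 1) + (2 * (a : ℝ) + 1)) / 4) * Far) := by ring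
  rw [hcol] at htot
  have hlam := lam_nonneg r a D (Γ := Γ) (q := q) hE0 hRr0 hΓ0 hq0
  have hμ := mu_nonneg r a D (τ := τ) (Far := Far) hK0' hn0 hτ hFar0
  exact htot.trans (rel_of_floor hV hLB hVA hLBl hlam hμ)

end Summit.PneNP.PneNP.Theorems.ChebyshevTracialDesignGammaDirectionSecondMomentRelative

end
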